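import Summits.QuantumAdvantage.QuantumAdvantage.Theorems.HolonomyDialSelfCorrect

/-!
# HolonomyDial — Orbit (cell decomp-qadv, seat lens-2, generation 13; supports item 26531 `ExactnessDial.PolyLossOddU3`)

§H part 1: adjacent double flips anywhere (`Wtot_flipAdj`, `hol_flipAdj`, `zpar_flipAdj_of_ne`, `holZ_flipAdj`), the three flips `fl` and the four orbit points (`holZ_orbit`), the six-of-eight CORE `core_le_six` (kernel `decide`; keep the `set_option`), the event polynomial `eInd`/`eIndP` (`eInd_mem`, degree `8D`), `mem_compatSet_of_avoid`.

Split (≤ 400 lines, part 8/11) of the node file `HOME/decomp-qadv-lens-2/g13/HolonomyDial.lean` (v5, sha256 fb2c0281…,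
farm rc 0, no placeholders); declarations verbatim, namespace `Summit.QuantumAdvantage.QuantumAdvantage.Theorems.HolonomyDial`.
Record: NODE-g13.md.
-/

set_option linter.dupNamespace false

noncomputable section
open scoped Classical

namespace Summit.QuantumAdvantage.QuantumAdvantage.Theorems

open Finset
open Literature.Computability.QuantumComplexity Literature.Computability.QuantumComplexity.RingHLF
open Literature.Computability.MetaComplexity Literature.Computability.MetaComplexity.Smolensky
open Summit.QuantumAdvantage.AdviceFreeQNC0
open Summit.QuantumAdvantage.QuantumAdvantage.Theses (ExactnessDial.PolyLossOddU3 ExactnessDial.NoPerfectOdd3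
  ExactnessDial.NoPerfectConst3 ExactnessDial.MassStep3u ExactnessDial.OddToAll3 ExactnessDial.DPLift3
  ExactnessDial.MultiRingBridge3 ExactnessDial.closes)

namespace HolonomyDial

/-! ## §H AVOID is a THEOREM too — `HolAvoidLoss3` PROVED by three far-apart double flips

Lens-2 generation 13, second half.  The crux of the first half falls to a degree argument after all, so the honest
node equation becomes `T ⟺ AvoidLift3` (the dial below WIN is exhausted by theorems):

* three commuting ADJACENT double flips `f_i = flip2 (i·m-1) (i·m)` (`i = 1,2,3`, blocks of length `m`, `4m ≤ N`)
  shift the holonomy by `σ_i(x) = 1 + [zpar x (i·m)] ∈ {1,2}` and leave the other two `σ_j` unchanged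
  (`hol_flipAdj`, `zpar_flipAdj_of_ne`); on the `Z₂²`-orbit `{x, f₃x, f₁f₂x, f₁f₂f₃x}` the holonomy reads
  `h, h+σ₃, h+σ₁+σ₂, h+σ₁+σ₂+σ₃`;
* CORE (kernel `decide`, 81 × 8 cases, `core_le_six`): for every value pattern `(a,b,c,d) ∈ 𝔽₃⁴` of an avoider on
  the orbit at most SIX of the eight sign patterns `(z₁,z₂,z₃)` admit a holonomy `h` avoided at all four points;
* EQUIDISTRIBUTION (the (D) engine, fibre-wise Smolensky on four free odd blocks): on every set cut out by a
  polylog-degree polynomial the three prefix parities `zpar x (i·m)` are jointly equidistributed over the odd class up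
  to `O(2^N · D/√m)` (`step_le`, `chain4`, `pattern_bound`), so at most `3552/4096 < 7/8` of the odd class lies in
  fully avoided orbits and a quarter of the rest are agreement points: `2^{N-1} ≤ 32 · #{x odd : L x = hol x}`
  (`avoid_count`, degree budget `2^26·D² ≤ m`, `4m ≤ N`), whence `holAvoidLoss3 : HolAvoidLoss3` with `C = 1` and the
  node collapse `polyLossOddU3_iff_avoidLift3 : T ⟺ AvoidLift3`. -/

section AvoidHard

variable {N : ℕ}

/-! ### H1. adjacent double flips anywhere on the ring -/

/-- Ring-game helper `Wk_eq_of_agree_prefix` (lens-2 law package; see the module docstring). -/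
theorem Wk_eq_of_agree_prefix (x x' : Fin N → Bool) (K : ℕ) (hK : K ≤ N)
    (hag : ∀ j : Fin N, j.val < K → x j = x' j) : ∀ k, k ≤ K → zpar x k = zpar x' k ∧ Wk x k = Wk x' k := by
  intro k hk
  have h := walk_agree x x' 0 K hK (by rw [zpar_zero, zpar_zero]) (fun j _ hj => hag j hj) k (Nat.zero_le _) hk
  rw [Wk_zero, Wk_zero] at h
  exact ⟨h.1, by omega⟩

/-- the weight shift of the adjacent double flip at `(a, a+1)`: `W(f x) + 2[zpar x (a+1)] = W(x) + 1`. -/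
theorem Wtot_flipAdj (x : Fin N → Bool) {a : ℕ} (ha : a + 3 ≤ N) :
    Wtot (flip2 a (a + 1) x) + 2 * (if zpar x (a + 1) then 1 else 0) = Wtot x + 1 := by
  have hz := zpar_flip2 (show a < a + 1 by omega) x
  set y := flip2 a (a + 1) x with hy
  -- prefix up to a agrees
  have hpre := Wk_eq_of_agree_prefix y x a (by omega) (fun j hj => flip2_apply_of_ne x (by omega) (by omega)) a le_rfl
  -- steps a → a+1 → a+2
  have s1y := Wk_succ y (k := a) (by omega)
  have s1x := Wk_succ x (k := a) (by omega)
  have s2y := Wk_succ y (k := a + 1) (by omega)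
  have s2x := Wk_succ x (k := a + 1) (by omega)
  rw [uCoord_eq_zpar] at s1y s1x s2y s2x
  have z1 : zpar y (a + 1) = !zpar x (a + 1) := by rw [hz (a + 1) (by omega), if_pos (by omega)]
  have z2 : zpar y (a + 2) = zpar x (a + 2) := by rw [hz (a + 2) (by omega), if_neg (by omega)]
  -- from a+2 to N-1 the walks agree
  have hag := (walk_agree y x (a + 2) (N - 1) (by omega) z2
    (fun j hj _ => flip2_apply_of_ne x (by omega) (by omega)) (N - 1) (by omega) le_rfl).2
  unfold Wtot
  have e1y : Wk y (a + 1) = Wk y a + (if zpar y (a + 1) = true then 1 else 0) := s1y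
  have e1x : Wk x (a + 1) = Wk x a + (if zpar x (a + 1) = true then 1 else 0) := s1x
  have e2y : Wk y (a + 2) = Wk y (a + 1) + (if zpar y (a + 1 + 1) = true then 1 else 0) := s2y
  have e2x : Wk x (a + 2) = Wk x (a + 1) + (if zpar x (a + 1 + 1) = true then 1 else 0) := s2x
  rw [show a + 1 + 1 = a + 2 from rfl] at e2y e2x
  rw [z1] at e1y
  rw [z2] at e2y
  rw [hpre.2] at e1y
  cases h1 : zpar x (a + 1) <;> cases h2 : zpar x (a + 2) <;> simp [h1, h2] at e1y e1x e2y e2x ⊢ <;> omega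

/-- Ring-game helper `hol_flipAdj` (lens-2 law package; see the module docstring). -/
theorem hol_flipAdj (x : Fin N → Bool) {a : ℕ} (ha : a + 3 ≤ N) :
    hol (flip2 a (a + 1) x) = (hol x + 1 + (if zpar x (a + 1) then 1 else 0)) % 3 := by
  have h := Wtot_flipAdj x ha
  unfold hol
  cases h2 : zpar x (a + 1) <;> simp [h2] at h ⊢ <;> omega

/-- a far adjacent flip does not move the sign bit `zpar x (a+1)`. -/
theorem zpar_flipAdj_of_ne (x : Fin N → Bool) {a b : ℕ} (hab : a ≠ b) (ha : a + 1 ≤ N) :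
    zpar (flip2 b (b + 1) x) (a + 1) = zpar x (a + 1) := by
  rw [zpar_flip2 (show b < b + 1 by omega) x (a + 1) ha, if_neg (by omega)]

/-- the sign of a flip as an `𝔽₃` value: `σ = 1 + [z]`. -/
def sg (z : Bool) : ZMod 3 := if z then 2 else 1

/-- Ring-game helper `holZ_flipAdj` (lens-2 law package; see the module docstring). -/
theorem holZ_flipAdj (x : Fin N → Bool) {a : ℕ} (ha : a + 3 ≤ N) :
    ((hol (flip2 a (a + 1) x) : ℕ) : ZMod 3) = ((hol x : ℕ) : ZMod 3) + sg (zpar x (a + 1)) := by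
  rw [hol_flipAdj x ha]
  have hx : hol x < 3 := Nat.mod_lt _ (by norm_num)
  unfold sg
  generalize hol x = v at hx ⊢
  interval_cases v <;> cases zpar x (a + 1) <;> decide

/-! ### H2. the three flips and the four orbit points -/

section Orbit

variable (m : ℕ)

/-- `f_i = flip2 (i·m - 1) (i·m)`. -/
def fl (i : ℕ) (x : Fin N → Bool) : Fin N → Bool := flip2 (i * m - 1) (i * m) x

/-- the sign bits `z_i = zpar x (i·m)`. -/
def zb (i : ℕ) (x : Fin N → Bool) : Bool := zpar x (i * m)

variable {m}

/-- Ring-game helper `fl_eq` (lens-2 law package; see the module docstring). -/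
theorem fl_eq (hm : 1 ≤ m) (i : ℕ) (hi : 1 ≤ i) (x : Fin N → Bool) :
    fl m i x = flip2 (i * m - 1) (i * m - 1 + 1) x := by
  unfold fl
  have : i * m - 1 + 1 = i * m := by
    have : 1 ≤ i * m := Nat.one_le_iff_ne_zero.mpr (Nat.mul_ne_zero (by omega) (by omega))
    omega
  rw [this]

/-- Ring-game helper `holZ_fl` (lens-2 law package; see the module docstring). -/
theorem holZ_fl (hm : 1 ≤ m) {i : ℕ} (hi : 1 ≤ i) (hN : i * m + 2 ≤ N) (x : Fin N → Bool) :
    ((hol (fl m i x) : ℕ) : ZMod 3) = ((hol x : ℕ) : ZMod 3) + sg (zb m i x) := by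
  have h1 : 1 ≤ i * m := le_trans hi (Nat.le_mul_of_pos_right _ hm)
  rw [fl_eq hm i hi, holZ_flipAdj x (a := i * m - 1) (by omega)]
  unfold zb
  rw [show i * m - 1 + 1 = i * m by omega]

/-- Ring-game helper `zb_fl_of_ne` (lens-2 law package; see the module docstring). -/
theorem zb_fl_of_ne (hm : 1 ≤ m) {i j : ℕ} (hi : 1 ≤ i) (hj : 1 ≤ j) (hij : i ≠ j) (hN : i * m ≤ N)
    (x : Fin N → Bool) : zb m i (fl m j x) = zb m i x := by
  have h1 : 1 ≤ i * m := le_trans hi (Nat.le_mul_of_pos_right _ hm)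
  have h1' : 1 ≤ j * m := le_trans hj (Nat.le_mul_of_pos_right _ hm)
  unfold zb
  rw [fl_eq hm j hj, show i * m = (i * m - 1) + 1 by omega]
  refine zpar_flipAdj_of_ne x ?_ (by omega)
  intro h
  apply hij
  have : i * m = j * m := by omega
  exact Nat.eq_of_mul_eq_mul_right hm this

/-- Ring-game helper `oddZeros_fl` (lens-2 law package; see the module docstring). -/
theorem oddZeros_fl (hm : 1 ≤ m) {i : ℕ} (hi : 1 ≤ i) (hN : i * m < N) (x : Fin N → Bool) :
    OddZeros (fl m i x) ↔ OddZeros x := by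
  have h1 : 1 ≤ i * m := le_trans hi (Nat.le_mul_of_pos_right _ hm)
  rw [fl_eq hm i hi]
  exact oddZeros_flip2 (by omega) (by omega) x

/-- Ring-game helper `fl_fl` (lens-2 law package; see the module docstring). -/
theorem fl_fl (i : ℕ) (x : Fin N → Bool) : fl m i (fl m i x) = x := flip2_flip2 _ _ x

/-- the holonomy at the four orbit points `x, f₃x, f₁f₂x, f₁f₂f₃x`. -/
theorem holZ_orbit (hm : 1 ≤ m) (hN : 3 * m + 2 ≤ N) (x : Fin N → Bool) :
    ((hol (fl m 3 x) : ℕ) : ZMod 3) = ((hol x : ℕ) : ZMod 3) + sg (zb m 3 x) ∧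
    ((hol (fl m 1 (fl m 2 x)) : ℕ) : ZMod 3) = ((hol x : ℕ) : ZMod 3) + sg (zb m 1 x) + sg (zb m 2 x) ∧
    ((hol (fl m 1 (fl m 2 (fl m 3 x))) : ℕ) : ZMod 3) =
      ((hol x : ℕ) : ZMod 3) + sg (zb m 1 x) + sg (zb m 2 x) + sg (zb m 3 x) := by
  refine ⟨holZ_fl hm (by norm_num) (by omega) x, ?_, ?_⟩
  · rw [holZ_fl hm (i := 1) (by norm_num) (by omega), holZ_fl hm (i := 2) (by norm_num) (by omega),
      zb_fl_of_ne hm (i := 1) (j := 2) (by norm_num) (by norm_num) (by norm_num) (by omega)]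
    ring
  · rw [holZ_fl hm (i := 1) (by norm_num) (by omega), holZ_fl hm (i := 2) (by norm_num) (by omega),
      holZ_fl hm (i := 3) (by norm_num) (by omega),
      zb_fl_of_ne hm (i := 1) (j := 2) (by norm_num) (by norm_num) (by norm_num) (by omega),
      zb_fl_of_ne hm (i := 1) (j := 3) (by norm_num) (by norm_num) (by norm_num) (by omega),
      zb_fl_of_ne hm (i := 2) (j := 3) (by norm_num) (by norm_num) (by norm_num) (by omega)]
    ring

end Orbit

/-! ### H3. the combinatorial core: at most six of eight sign patterns are compatible -/

/-- the avoider's four values `(a,b,c,d)` on the orbit are compatible with the sign bits `z` and the holonomy `h`. -/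
def Compat (v : ZMod 3 × ZMod 3 × ZMod 3 × ZMod 3) (z : Bool × Bool × Bool) (h : ZMod 3) : Prop :=
  v.1 ≠ h ∧ v.2.1 ≠ h + sg z.2.2 ∧ v.2.2.1 ≠ h + sg z.1 + sg z.2.1 ∧ v.2.2.2 ≠ h + sg z.1 + sg z.2.1 + sg z.2.2

/-- HolonomyDial helper instance (decidability by unfolding; lens-2 g13 package). -/
instance (v : ZMod 3 × ZMod 3 × ZMod 3 × ZMod 3) (z : Bool × Bool × Bool) (h : ZMod 3) : Decidable (Compat v z h) := by
  unfold Compat; infer_instance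

/-- the set of compatible sign patterns. -/
def compatSet (v : ZMod 3 × ZMod 3 × ZMod 3 × ZMod 3) : Finset (Bool × Bool × Bool) :=
  univ.filter fun z => ∃ h : ZMod 3, Compat v z h

set_option maxHeartbeats 800000 in
/-- **CORE**: never more than six compatible sign patterns. -/
theorem core_le_six : ∀ v : ZMod 3 × ZMod 3 × ZMod 3 × ZMod 3, (compatSet v).card ≤ 6 := by
  unfold compatSet Compat
  decide

/-! ### H4. the event `q ∈ A(data x)` is cut out by a polynomial of degree `8D` -/

section Event

variable (m : ℕ) (L : CubeFn (ZMod 3) N)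

/-- the avoider's values at the four orbit points. -/
def dat (x : Fin N → Bool) : ZMod 3 × ZMod 3 × ZMod 3 × ZMod 3 :=
  (L x, L (fl m 3 x), L (fl m 1 (fl m 2 x)), L (fl m 1 (fl m 2 (fl m 3 x))))

/-- indicator of `q ∈ compatSet (dat x)`. -/
def eInd (q : Bool × Bool × Bool) : CubeFn (ZMod 3) N := fun x => if q ∈ compatSet (dat m L x) then 1 else 0

/-- the same indicator as a sum of products of value indicators. -/
def eIndP (q : Bool × Bool × Bool) : CubeFn (ZMod 3) N :=
  ∑ v ∈ (univ.filter fun v : ZMod 3 × ZMod 3 × ZMod 3 × ZMod 3 => q ∈ compatSet v),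
    indP L v.1 * indP (fun x => L (fl m 3 x)) v.2.1 * indP (fun x => L (fl m 1 (fl m 2 x))) v.2.2.1 *
      indP (fun x => L (fl m 1 (fl m 2 (fl m 3 x)))) v.2.2.2

variable {m L}

/-- Ring-game helper `eIndP_mem` (lens-2 law package; see the module docstring). -/
theorem eIndP_mem {D : ℕ} (hL : L ∈ lowDeg (ZMod 3) N D) (q : Bool × Bool × Bool) :
    eIndP m L q ∈ lowDeg (ZMod 3) N (8 * D) := by
  unfold eIndP
  refine Submodule.sum_mem _ fun v _ => ?_
  have h0 : indP L v.1 ∈ lowDeg (ZMod 3) N (D + D) := indP_mem hL _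
  have h3 : indP (fun x => L (fl m 3 x)) v.2.1 ∈ lowDeg (ZMod 3) N (D + D) := indP_mem (comp_flip2_mem _ _ hL) _
  have h12 : indP (fun x => L (fl m 1 (fl m 2 x))) v.2.2.1 ∈ lowDeg (ZMod 3) N (D + D) :=
    indP_mem (comp_flip2_mem _ _ (P := fun x => L (fl m 1 x)) (comp_flip2_mem _ _ hL)) _
  have h123 : indP (fun x => L (fl m 1 (fl m 2 (fl m 3 x)))) v.2.2.2 ∈ lowDeg (ZMod 3) N (D + D) :=
    indP_mem (comp_flip2_mem _ _ (P := fun x => L (fl m 1 (fl m 2 x)))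
      (comp_flip2_mem _ _ (P := fun x => L (fl m 1 x)) (comp_flip2_mem _ _ hL))) _
  have hprod := mul_mem_lowDeg_add (mul_mem_lowDeg_add (mul_mem_lowDeg_add h0 h3) h12) h123
  exact lowDeg_mono (by omega) hprod

/-- Ring-game helper `eIndP_apply` (lens-2 law package; see the module docstring). -/
theorem eIndP_apply (q : Bool × Bool × Bool) (x : Fin N → Bool) : eIndP m L q x = eInd m L q x := by
  unfold eIndP eInd
  rw [Finset.sum_apply]
  have hterm : ∀ v : ZMod 3 × ZMod 3 × ZMod 3 × ZMod 3,
      (indP L v.1 * indP (fun x => L (fl m 3 x)) v.2.1 * indP (fun x => L (fl m 1 (fl m 2 x))) v.2.2.1 *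
        indP (fun x => L (fl m 1 (fl m 2 (fl m 3 x)))) v.2.2.2) x = if dat m L x = v then 1 else 0 := by
    intro v
    simp only [Pi.mul_apply, indP_apply]
    unfold dat
    rcases v with ⟨a, b, c, d⟩
    simp only [Prod.mk.injEq]
    by_cases h1 : L x = a <;> by_cases h2 : L (fl m 3 x) = b <;> by_cases h3 : L (fl m 1 (fl m 2 x)) = c <;>
      by_cases h4 : L (fl m 1 (fl m 2 (fl m 3 x))) = d <;> simp [h1, h2, h3, h4]
  simp_rw [hterm]
  rw [Finset.sum_ite_eq]
  simp only [mem_filter, mem_univ, true_and]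

/-- Ring-game helper `eInd_mem` (lens-2 law package; see the module docstring). -/
theorem eInd_mem {D : ℕ} (hL : L ∈ lowDeg (ZMod 3) N D) (q : Bool × Bool × Bool) :
    eInd m L q ∈ lowDeg (ZMod 3) N (8 * D) := by
  have e : eInd m L q = eIndP m L q := by funext x; rw [eIndP_apply]
  rw [e]; exact eIndP_mem hL q

/-- Ring-game helper `eInd_apply` (lens-2 law package; see the module docstring). -/
theorem eInd_apply (q : Bool × Bool × Bool) (x : Fin N → Bool) :
    eInd m L q x = if q ∈ compatSet (dat m L x) then 1 else 0 := rfl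

/-- **orbit avoidance forces compatibility**: if `L` avoids the holonomy at the four orbit points of an `x` then the
sign pattern of `x` is compatible with the data. -/
theorem mem_compatSet_of_avoid (hm : 1 ≤ m) (hN : 3 * m + 2 ≤ N) (x : Fin N → Bool)
    (h0 : L x ≠ ((hol x : ℕ) : ZMod 3)) (h3 : L (fl m 3 x) ≠ ((hol (fl m 3 x) : ℕ) : ZMod 3))
    (h12 : L (fl m 1 (fl m 2 x)) ≠ ((hol (fl m 1 (fl m 2 x)) : ℕ) : ZMod 3))
    (h123 : L (fl m 1 (fl m 2 (fl m 3 x))) ≠ ((hol (fl m 1 (fl m 2 (fl m 3 x))) : ℕ) : ZMod 3)) :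
    (zb m 1 x, zb m 2 x, zb m 3 x) ∈ compatSet (dat m L x) := by
  obtain ⟨e3, e12, e123⟩ := holZ_orbit hm hN x
  unfold compatSet
  rw [mem_filter]
  refine ⟨mem_univ _, ((hol x : ℕ) : ZMod 3), ?_⟩
  unfold Compat dat
  refine ⟨h0, ?_, ?_, ?_⟩
  · rw [← e3]; exact h3
  · rw [← e12]; exact h12
  · rw [← e123]; exact h123

end Event
end AvoidHard

end HolonomyDial

end Summit.QuantumAdvantage.QuantumAdvantage.Theorems
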